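import Mathlib
import HarnessLib
import Summits.HubbardSuperconductivity.HubbardSuperconductivity.Theorems.KLProgrammeKLRegimeSplitSlotsV17F
import Summits.HubbardSuperconductivity.HubbardSuperconductivity.Theorems.KLProgrammeKLRegimeEngineV8DefsG6Reading
import Summits.HubbardSuperconductivity.HubbardSuperconductivity.Theorems.KLProgrammeKLRegimeEngineValueClauseReductionV11

/-!
# K3 ENGINE-FLOW child (gen 7-flow, `KLRegimeEngineV17F := EngineP4 klPredsV17F klWindowC`; K3-FLOW RULING F, KL STATUS 2026-08-27T10:17:21Z),
# stub (c) `stub_engine_step_values` (F shape): the VALUE-LANE re-key on the V17F slot texts — S6 «k3c2-p2 token re-key», part 1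
# (cell gate-hubbard-kl, seat hubbard-kl-k3c2-p2 g7)

The V17F value clauses (`…SplitSlotsV17F` §2, p524744) are the V10/V7 texts with the scale-`n` objects at the flow frame `K_n := klFlowFrameU L M β U μ n`,
the scale-`(n−1)` objects at `K_{n−1}`, the BARE reading ball `klBall L μ 0`, and `+ frameShiftBar P Q U n` in the step majorants.  This file ports the
parts of the value lane that do not read the ladder array (the (E2-F) in-class reduction and its band door wait for the pen's word on the array's
truncation ball — KL STATUS k3c2-p2 g7 11:00Z «BALL MISMATCH»):

* §1 **`klvrF_quarticValueIncrementAtV17F_of_pairValueIncrementAtV17F`** — (E2′-F) is a COROLLARY of (E2″-F) (the klka identity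
  `λ_m^{↑↓}[K](k₁,k₂,k₃) = 𝒞_m[K](k₁+k₃;k₂,k₁)` at `(K_n, n)` and at `(K_{n−1}, n−1)`; counts permutation-invariant);
* §2 band doors (G-generic, `G/P/Q` well formed): **`klbandF_pairValueIncrementAtV17F_of_le_thermalBar`**, **`klbandF_quarticValueIncrementAtV17F_of_le_thermalBar`**
  — sign-blind CROSS-FRAME increments `≤ thermalBar G P U β n` give (E2″-F)/(E2′-F) (the extra `frameShiftBar ≥ 0` only helps);
* §3 at the package of record `klEngGeo6` (p524309): **`klg6F_values_of_signBlind_band`** — in the band `nScales β ≤ n + T`, sign-blind bounds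
  `‖𝒞_n[K_n] − 𝒞_{n−1}[K_{n−1}]‖ ≤ Cp·(Klam U)²` (every `Qm`, bare ball²), `Cp·4^T ≤ 2^80`, give `(E2″-F)_n ∧ (E2′-F)_n`; with (E5-F) by name this is
  stub (c)'s conclusion minus the (E2-F) conjunct.

Bookkeeping only; nothing about the model is asserted; nothing asserts superconductivity.
-/

noncomputable section

namespace Summit.HubbardSuperconductivity.HubbardSuperconductivity.Theorems.KLRegimeSplit

set_option linter.dupNamespace false -- summit = problem name (single-conjunct summit), D-0017

open Real Finset Literature.MathematicalPhysics.QuantumLattice Literature.Probability.LatticeModels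
open Summit.HubbardSuperconductivity.HubbardSuperconductivity.Theorems.KLProgrammeLegKernels
open Summit.HubbardSuperconductivity.HubbardSuperconductivity.Theorems.EngineV8

section Model

variable {L M : ℕ} [NeZero L] [NeZero M] {G : GeoConsts} {P : SplitConsts} {Q : EngConsts} {β U μ : ℝ} {n : ℕ}

/-! ## §1 (E2′-F) from (E2″-F) -/

/-- **(E2′-F) is a corollary of (E2″-F)** at every scale: the `↑↓` value increment at `(k₁,k₂,k₃)` between `(K_n, n)` and `(K_{n−1}, n−1)` is the
pair-amplitude increment at total momentum `k₁ + k₃` read at `(k₂, k₁)`, with the same three transfers and the same crossing-leg count at `K_n`. -/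
theorem klvrF_quarticValueIncrementAtV17F_of_pairValueIncrementAtV17F (h : PairValueIncrementAtV17F L M G P Q β U μ n) :
    QuarticValueIncrementAtV17F L M G P Q β U μ n := by
  intro hn k₁ hk₁ k₂ hk₂ k₃ hk₃
  have h1 := h hn (k₁ + k₃) k₂ hk₂ k₁ hk₁
  rw [klka_quarticValue_eq_pairAmplitude, klka_quarticValue_eq_pairAmplitude]
  have e1 : k₂ + k₁ - (k₁ + k₃) = k₂ - k₃ := by abel
  have e2 : k₁ + k₃ - k₁ = k₃ := by abel
  have e3 : k₁ + k₃ - k₂ = k₁ - k₂ + k₃ := by abel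
  rw [e1, e2, e3, klvr_klTorusNorm_sub_comm k₂ k₁, klvr_legSliceCountT_eq_of_perm_0231] at h1
  exact h1

/-! ## §2 Band doors for the cross-frame value clauses (G-generic) -/

/-- **(E2″-F)_n from a sign-blind CROSS-FRAME pair-increment bound inside `thermalBar`**: if on the bare ball, for every `Qm`,
`‖𝒞_n[K_n](Qm;k,k′) − 𝒞_{n−1}[K_{n−1}](Qm;k,k′)‖ ≤ thermalBar G P U β n`, then `PairValueIncrementAtV17F … n` (the other budget terms, including
`frameShiftBar`, are `≥ 0`). -/
theorem klbandF_pairValueIncrementAtV17F_of_le_thermalBar (hG : G.WF) (hP : P.WF) (hQ : Q.WF)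
    (h : ∀ Qm : TorusSite 2 L, ∀ k ∈ klBall L μ 0, ∀ k' ∈ klBall L μ 0,
      ‖klPairAmplitude L M β U μ (klFlowFrameU L M β U μ n) n Qm k k' -
          klPairAmplitude L M β U μ (klFlowFrameU L M β U μ (n - 1)) (n - 1) Qm k k'‖ ≤ thermalBar G P U β n) :
    PairValueIncrementAtV17F L M G P Q β U μ n := by
  intro _ Qm k hk k' hk'
  have hK : 0 ≤ P.Klam := zero_le_one.trans hP.1
  have hgain := klband_gainBar_nonneg hG P U n (klTorusNorm L Qm) (klTorusNorm L (k - k')) (klTorusNorm L (k + k' - Qm))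
  have herem := eremBar_nonneg' hG hP hQ U β L (n - 1)
  have hleg := legDressBarQ2_nonneg G hK hQ.2.1 U n
    (legSliceCountT L β μ (klFlowFrameU L M β U μ n) n ![k', Qm - k', Qm - k, k])
  have hfs := frameShiftBar_nonneg (P := P) hQ.2.1 U n
  linarith [h Qm k hk k' hk']

/-- **(E2′-F)_n from a sign-blind CROSS-FRAME coupling-increment bound inside `thermalBar`**. -/
theorem klbandF_quarticValueIncrementAtV17F_of_le_thermalBar (hG : G.WF) (hP : P.WF) (hQ : Q.WF)
    (h : ∀ k₁ ∈ klBall L μ 0, ∀ k₂ ∈ klBall L μ 0, ∀ k₃ ∈ klBall L μ 0,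
      ‖klQuarticValue L M β U μ (klFlowFrameU L M β U μ n) n 0 1 k₁ k₂ k₃ -
          klQuarticValue L M β U μ (klFlowFrameU L M β U μ (n - 1)) (n - 1) 0 1 k₁ k₂ k₃‖ ≤ thermalBar G P U β n) :
    QuarticValueIncrementAtV17F L M G P Q β U μ n := by
  intro _ k₁ hk₁ k₂ hk₂ k₃ hk₃
  have hK : 0 ≤ P.Klam := zero_le_one.trans hP.1
  have hgain := klband_gainBar_nonneg hG P U n (klTorusNorm L (k₁ + k₃)) (klTorusNorm L (k₁ - k₂)) (klTorusNorm L (k₂ - k₃))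
  have herem := eremBar_nonneg' hG hP hQ U β L (n - 1)
  have hleg := legDressBarQ2_nonneg G hK hQ.2.1 U n
    (legSliceCountT L β μ (klFlowFrameU L M β U μ n) n ![k₁, k₂, k₃, k₁ - k₂ + k₃])
  have hfs := frameShiftBar_nonneg (P := P) hQ.2.1 U n
  linarith [h k₁ hk₁ k₂ hk₂ k₃ hk₃]

/-- **Both value clauses of the band from ONE sign-blind pair-increment bound** (the `↑↓` increment is a pair increment, §1). -/
theorem klbandF_values_of_le_thermalBar (hG : G.WF) (hP : P.WF) (hQ : Q.WF)
    (h : ∀ Qm : TorusSite 2 L, ∀ k ∈ klBall L μ 0, ∀ k' ∈ klBall L μ 0,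
      ‖klPairAmplitude L M β U μ (klFlowFrameU L M β U μ n) n Qm k k' -
          klPairAmplitude L M β U μ (klFlowFrameU L M β U μ (n - 1)) (n - 1) Qm k k'‖ ≤ thermalBar G P U β n) :
    PairValueIncrementAtV17F L M G P Q β U μ n ∧ QuarticValueIncrementAtV17F L M G P Q β U μ n :=
  have h1 := klbandF_pairValueIncrementAtV17F_of_le_thermalBar hG hP hQ h
  ⟨h1, klvrF_quarticValueIncrementAtV17F_of_pairValueIncrementAtV17F h1⟩

end Model

/-! ## §3 At the package of record `klEngGeo6` -/

section Package

variable {L M : ℕ} [NeZero L] [NeZero M] {P : SplitConsts} {Q : EngConsts} {β U μ : ℝ} {n T : ℕ} {Cp : ℝ}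

/-- **The (E2″-F)/(E2′-F)/(E5-F) conjuncts of `stub_engine_step_values` (F shape) in the thermal band, from ONE sign-blind bound**
(package `klEngGeo6`, any well-formed `Q`, e.g. `klEngQ6 P R` by `klEngQ6_wf`): `1 ≤ n`, `nScales β ≤ n + T`,
`‖𝒞_n[K_n] − 𝒞_{n−1}[K_{n−1}]‖ ≤ Cp·(Klam U)²` on the bare ball for every `Qm`, `Cp·4^T ≤ 2^80`, and (E5-F) by name. -/
theorem klg6F_values_of_signBlind_band (hP : P.WF) (hQ : Q.WF) (hband : nScales β ≤ n + T)
    (hCp : 0 ≤ Cp) (hCpT : Cp * 4 ^ T ≤ 2 ^ 80)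
    (hpair : ∀ Qm : TorusSite 2 L, ∀ k ∈ klBall L μ 0, ∀ k' ∈ klBall L μ 0,
      ‖klPairAmplitude L M β U μ (klFlowFrameU L M β U μ n) n Qm k k' -
          klPairAmplitude L M β U μ (klFlowFrameU L M β U μ (n - 1)) (n - 1) Qm k k'‖ ≤ Cp * (P.Klam * U) ^ 2)
    (hE5 : IsoTupleL1AtV17F L M klEngGeo6 P β U μ n) :
    PairValueIncrementAtV17F L M klEngGeo6 P Q β U μ n ∧ QuarticValueIncrementAtV17F L M klEngGeo6 P Q β U μ n ∧
      IsoTupleL1AtV17F L M klEngGeo6 P β U μ n := by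
  have h := klbandF_values_of_le_thermalBar (G := klEngGeo6) klEngGeo6_wf hP hQ
    (fun Qm k hk k' hk' => klg6_band_le_thermalBar hCp hCpT hband (hpair Qm k hk k' hk'))
  exact ⟨h.1, h.2, hE5⟩

end Package

end Summit.HubbardSuperconductivity.HubbardSuperconductivity.Theorems.KLRegimeSplit

end
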